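import Literature.AlgebraicGeometry.HodgeTheory.PolarizedLimitMixedHodgeStructureRescaledLimit
import HarnessLib

/-!
# The rescaled limit of a sequence of APPROXIMATE Hodge classes near the puncture is an `𝔰𝔩₂`-invariant limit Hodge class
# (Cattani–Deligne–Kaplan, Prop. 4.7, one variable, nilpotent orbit, with the error term `u(n) ∼_z Φ⁰(z(n))` of Thm. 2.16)

Topic `Literature/AlgebraicGeometry/HodgeTheory` (namespace `…HodgeTheory.PolarizedLimitMixedHodgeStructure`).  Theorems only; no
definition, no instance, no named fact (D-0026 net debt `0`).  The sequel of `…RescaledLimit.lean`, which proves CDK Prop. 4.7 at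
`d = 1` for EXACT Hodge classes `x_n ∈ H^{p,k−p}(θ(z_n))` (`sl2_invariant_of_deligneEProj_eq_const`); here the hypothesis is weakened
to the printed one — `x_n` is only CLOSE to `F^pθ(z_n)` in the Hodge metric at `θ(z_n)`, with an error tending to `0`.

PRINTED SOURCE, VERBATIM. E. Cattani, P. Deligne, A. Kaplan, *On the locus of Hodge classes*, J. Amer. Math. Soc. 8 (1995) 483–506.
**4.1** (p. 499): «We fix a sequence `(z(n), u(n))` with the following properties: `0 ≤ x_j(n) ≤ 1`, `inf_j y_j(n) → ∞`, `u(n) ∈ V_ℤ`,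
the Hodge norm `‖u(n)‖` of `u(n)` at `z(n)` is bounded, and, for some fixed `α > 0`, `u(n) ∼_{z(n)} Φ⁰(z(n))` (notation of 2.15).»
Proof of **Proposition 4.7** (pp. 503–504): «If we transform the assumption `u(n) ∼_z Φ⁰` by `e(τ(n))` (notations of (3.6.1)), we
obtain `e(τ(n))u(n) ∼_z e(τ(n))Φ⁰(z(n))` where angles are now taken in the Hodge metric for `e(τ(n))Φ(z(n))`. The Hodge norm of
`e(τ(n))u(n)` in this metric — equal to that of `u(n)` in the Hodge metric for `Φ(z(n))` — is bounded by assumption. The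
`e(τ(n))Φ(z(n))` tend to the Hodge filtration `F_♯` (cf. 3.6). The Hodge metric for `e(τ(n))Φ(z(n))` tends to that for `F_♯`. It
follows that `e(τ(n))u(n)` remains bounded and, taking a subsequence, we may and shall assume that it has a limit `u₀`. We have
`u₀ ∈ F_♯⁰`, real. … By 3.10, `u₀` is in the sum of the `V^l` with `l₁ = 0` and is in the kernel of `T₁`. … The `0`-component
`u(n)^{(0)}` coincides with `u₀`, killed by `T₁`.»

THE TREE'S SETTING (as in `…RescaledLimit.lean`): the nilpotent orbit `θ(z) = exp(zN)·F` of `L : PolarizedLimitMixedHodgeStructure V k`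
(`Im z > β = L.normThreshold`), the `δ`-splitting `(W, F̂)` with its grading `Ê_m`, projections `π̂_m`, reference norm `|·|₀ = ‖·‖_{F̂_♯}`,
`ĝ_z = exp((Re z)N) ρ̃(√Im z)` (`orbitAut`) with `θ(z)^p = ĝ_z·(u_{√Im z}·F̂_♯^p)` and `|u_t − 1|₀ = O(t⁻²)`, `‖ĝ_z w‖_{θ̂(z)} = |w|₀`,
`½‖·‖_{θ̂(z)} ≤ ‖·‖_{θ(z)} ≤ (3/2)‖·‖_{θ̂(z)}`.

MAIN THEOREM (`sl2_invariant_of_deligneEProj_eq_const_of_hodgeNorm_sub_le`, CDK Prop. 4.7 at `d = 1` AS PRINTED): let `k = p + p`,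
`x_n ∈ W_{k,ℂ}` REAL with `‖x_n‖_{θ(z_n)} ≤ C`, `Im z_n → ∞` (any `Re z_n`), and `f_n ∈ F^pθ(z_n)` with **`‖x_n − f_n‖_{θ(z_n)} ≤ ε_n → 0`**
(«`u(n) ∼_{z(n)} Φ⁰(z(n))`», any null sequence of errors), whose top components `π̂_k x_n = û` are CONSTANT.  Then **`N û = 0`,
`N̂⁺ û = 0`, `Ĥ û = 0`, `û ∈ Î^{p,p}`**.  Proof = the printed one: `w_n = ĝ_{z_n}⁻¹ x_n` is `|·|₀`-bounded by `2C`, real, in `W_k`,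
`π̂_k w_n = û`; `ĝ_{z_n}⁻¹ f_n = u_{t_n} f'_n` with `f'_n ∈ F̂_♯^p` and `|w_n − f'_n|₀ ≤ 2ε_n + (K/t_n²)(4C + 4ε_n) → 0`; a subsequence of
`w_n` converges to `u₀ ∈ W_{k,ℂ} ∩ F̂_♯^p`, real, `π̂_k u₀ = û`; CDK Prop. 3.10 (`…SharpInvariantClasses`) gives `u₀ ∈ Ê_k ∩ ker N ∩ ker N̂⁺
∩ Î^{p,p}`, so `u₀ = û`.  Corollaries: the exact theorem is recovered (`ε_n = 0`); the truncation form (`f_n = π_{≥p} x_n`,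
`‖π_{<p} x_n‖ ≤ ε_n`); the relative form `‖x_n − f_n‖ ≤ δ_n‖x_n‖` with `δ_n → 0` (e.g. `δ_n = e^{−α Im z_n}`, 2.15).

NOT HERE: the consequences «`T₁u(n)` exponentially small» (Prop. 4.8) and 4.9 — the next files; several variables.

## References

* [CattaniDeligneKaplan1995] E. Cattani, P. Deligne, A. Kaplan, *On the locus of Hodge classes*, J. Amer. Math. Soc. 8 (1995)
  483–506: 2.15 (p. 491), 4.1 (p. 499), Lemma 4.5 (iii) (p. 502), Prop. 4.7 and proof (pp. 503–504), Prop. 3.10 (p. 499).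
* [CattaniKaplanSchmid1987] E. Cattani, A. Kaplan, W. Schmid, LNM 1246 (1987): §3 Thm. (3.3) (i)–(ii), Cor. (3.7) (pp. 19–22).
* [Schmid1973] W. Schmid, Invent. Math. 22 (1973): Thm. (6.6) (cite only).
-/

noncomputable section

open scoped TensorProduct ComplexOrder
open Filter Topology

namespace Literature.AlgebraicGeometry

open Module
open Motives Motives.MixedHodgeStructure
open Motives.HodgeStructure (conj conj_conj complexConj mem_complexConj conj_apply_eq_endConj endConj)

universe u

variable {V : Type u} [AddCommGroup V] [Module ℚ V] [FiniteDimensional ℚ V] {k : ℤ}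

namespace HodgeTheory

namespace PolarizedLimitMixedHodgeStructure

variable (L : PolarizedLimitMixedHodgeStructure V k)

/-! ## §1 The rescaled error: `ĝ_z⁻¹` carries a Hodge-metric error at `θ(z)` to a `|·|₀`-error of at most twice the size -/

/-- **`|w − g|₀ ≤ 2‖x − f‖_{θ(z)}` for `ĝ_z w = x`, `ĝ_z g = f`, `Im z > β`**: transforming `u(n) ∼_z Φ⁰` by `e(τ(n))`, «angles are
now taken in the Hodge metric for `e(τ(n))Φ(z(n))`», which the tree controls by `|·|₀` up to the factor `2`.
[cite: CattaniDeligneKaplan1995, proof of Prop. 4.7 (pp. 503–504)] [cite: CattaniKaplanSchmid1987, §3 Cor. (3.7)] -/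
theorem referenceNorm_sub_le_two_mul_hodgeNorm_sub_of_orbitAut_eq {z : ℂ} (hz : L.normThreshold < z.im) {w g x f : ℂ ⊗[ℚ] V}
    (hw : L.deltaSplit.toLimitMixedHodgeStructure.orbitAut z w = x) (hg : L.deltaSplit.toLimitMixedHodgeStructure.orbitAut z g = f) :
    L.referenceNorm (w - g) ≤ 2 * (L.nilpotentOrbitPolarization z (L.orbitThreshold_lt_im hz)).hodgeNorm (x - f) :=
  L.referenceNorm_le_two_mul_hodgeNorm_of_orbitAut_eq hz (by rw [map_sub, hw, hg])

/-! ## §2 CDK Prop. 4.7 at `d = 1` with the error term of Thm. 2.16 -/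

/-- **CDK Prop. 4.7 for the one-variable nilpotent orbit, APPROXIMATE Hodge classes.**  Let `k = p + p`, `x_n ∈ W_{k,ℂ}` be REAL
(`x̄_n = x_n`) with `‖x_n‖_{θ(z_n)} ≤ C` at points `θ(z_n)`, `Im z_n > β`, `Im z_n → ∞` (any `Re z_n`), let `f_n ∈ F^pθ(z_n)` with
**`‖x_n − f_n‖_{θ(z_n)} ≤ ε_n`, `ε_n → 0`** («`u(n) ∼_{z(n)} Φ⁰(z(n))`»), and assume the top components `π̂_k x_n = û` of the
`δ`-grading are CONSTANT.  Then **`N û = 0`, `N̂⁺ û = 0`, `Ĥ û = 0` and `û ∈ Î^{p,p}`** — «taking a subsequence, we may and shall assume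
that it has a limit `u₀`. We have `u₀ ∈ F_♯⁰`, real. … By 3.10, `u₀` … is in the kernel of `T₁` … The `0`-component `u(n)^{(0)}`
coincides with `u₀`». [cite: CattaniDeligneKaplan1995, Prop. 4.7 and proof (pp. 503–504), 4.1 (p. 499), Prop. 3.10 (p. 499)]
[cite: CattaniKaplanSchmid1987, §3 Thm. (3.3), Cor. (3.7)] [cite: Schmid1973, Thm. (6.6) (cite only)] -/
theorem sl2_invariant_of_deligneEProj_eq_const_of_hodgeNorm_sub_le {p : ℤ} (hpk : p + p = k) (x : ℕ → ℂ ⊗[ℚ] V) (z : ℕ → ℂ)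
    (hz : ∀ n, L.normThreshold < (z n).im) (hlim : Tendsto (fun n => (z n).im) atTop atTop) {C : ℝ}
    (hC : ∀ n, (L.nilpotentOrbitPolarization (z n) (L.orbitThreshold_lt_im (hz n))).hodgeNorm (x n) ≤ C)
    (hreal : ∀ n, conj (x n) = x n) (hW : ∀ n, x n ∈ (L.W k).baseChange ℂ) (f : ℕ → ℂ ⊗[ℚ] V)
    (hf : ∀ n, f n ∈ (L.nilpotentOrbit (z n) (L.orbitThreshold_lt_im (hz n))).F p) (ε : ℕ → ℝ)
    (hε : ∀ n, (L.nilpotentOrbitPolarization (z n) (L.orbitThreshold_lt_im (hz n))).hodgeNorm (x n - f n) ≤ ε n)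
    (hε0 : Tendsto ε atTop (𝓝 0)) {û : ℂ ⊗[ℚ] V} (hû : ∀ n, L.deltaSplit.toMixedHodgeStructure.deligneEProj k (x n) = û) :
    L.N.baseChange ℂ û = 0 ∧ L.deltaSplit.toLimitMixedHodgeStructure.nPlus û = 0 ∧
      L.deltaSplit.toLimitMixedHodgeStructure.deligneH û = 0 ∧ û ∈ L.deltaSplit.toMixedHodgeStructure.deligneI p p := by
  classical
  -- notation
  have hs' := L.isSplitOverR_deltaSplit
  set P := L.deltaSplit.sharpPolarization L.isSplitOverR_deltaSplit with hP_def
  have hz0 : ∀ n, 0 < (z n).im := fun n => L.im_pos_of_normThreshold_lt (hz n)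
  have hε_nonneg : ∀ n, 0 ≤ ε n := fun n => (HodgeStructure.Polarization.hodgeNorm_nonneg _ _).trans (hε n)
  -- §2: the rescaled vectors `w n = ĝ_{z n}⁻¹ (x n)` and `g n = ĝ_{z n}⁻¹ (f n)`
  choose w hw using fun n => L.deltaSplit.toLimitMixedHodgeStructure.orbitAut_surjective (hz0 n) (x n)
  choose g hg using fun n => L.deltaSplit.toLimitMixedHodgeStructure.orbitAut_surjective (hz0 n) (f n)
  have hwn : ∀ n, L.referenceNorm (w n) ≤ 2 * C := fun n =>
    (L.referenceNorm_le_two_mul_hodgeNorm_of_orbitAut_eq (hz n) (hw n)).trans (by linarith [hC n])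
  have hwW : ∀ n, w n ∈ (L.W k).baseChange ℂ := fun n => L.mem_baseChange_W_of_orbitAut_eq (hz0 n) (hw n) (hW n)
  have hwr : ∀ n, conj (w n) = w n := fun n => L.conj_eq_of_orbitAut_eq (hz0 n) (hw n) (hreal n)
  have hwπ : ∀ n, L.deltaSplit.toMixedHodgeStructure.deligneEProj k (w n) = û := fun n => by
    rw [L.deligneEProj_self_eq_of_orbitAut_eq (hz0 n) (hw n) (hW n), hû n]
  -- the error after rescaling: `|w n - g n|₀ ≤ 2 ε n`
  have hwg : ∀ n, L.referenceNorm (w n - g n) ≤ 2 * ε n := fun n =>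
    (L.referenceNorm_sub_le_two_mul_hodgeNorm_sub_of_orbitAut_eq (hz n) (hw n) (hg n)).trans (by linarith [hε n])
  have hgF : ∀ n, g n ∈ ((L.deltaSplit.toLimitMixedHodgeStructure.sharp hs').F p).map (L.orbitPerturbation (Real.sqrt (z n).im)) :=
    fun n => L.mem_map_orbitPerturbation_sharp_F_of_orbitAut_eq (L.orbitThreshold_lt_im (hz n)) (hz0 n) (hg n) (hf n)
  choose f' hf'F hf'g using hgF
  obtain ⟨K, hK0, hK⟩ := L.exists_hodgeNorm_orbitPerturbation_sub_le
  have hC0 : 0 ≤ C := (HodgeStructure.Polarization.hodgeNorm_nonneg _ _).trans (hC 0)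
  -- the norm axioms of `|·|₀ = ‖·‖_{F̂_♯}` in `referenceNorm` form
  have hconj : ∀ v : ℂ ⊗[ℚ] V, L.referenceNorm (conj v) = L.referenceNorm v := fun v => P.hodgeNorm_conj v
  have hsubrev : ∀ v v' : ℂ ⊗[ℚ] V, L.referenceNorm (v - v') = L.referenceNorm (v' - v) := fun v v' => P.hodgeNorm_sub_rev v v'
  have hadd : ∀ v v' : ℂ ⊗[ℚ] V, L.referenceNorm (v + v') ≤ L.referenceNorm v + L.referenceNorm v' :=
    fun v v' => P.hodgeNorm_add_le v v'
  have htri : ∀ v v' : ℂ ⊗[ℚ] V, L.referenceNorm v ≤ L.referenceNorm v' + L.referenceNorm (v - v') :=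
    fun v v' => P.hodgeNorm_le_add_hodgeNorm_sub v v'
  -- `|g n|₀ ≤ 2C + 2 ε n`
  have hgn : ∀ n, L.referenceNorm (g n) ≤ 2 * C + 2 * ε n := fun n => by
    have h := htri (g n) (w n)
    rw [hsubrev (g n) (w n)] at h
    linarith [hwn n, hwg n]
  -- the estimate `|f' n - g n|₀ ≤ (K / Im (z n)) (4C + 4 ε n)` once `Im (z n) ≥ 2K`
  have hfg_est : ∀ n, 2 * K ≤ (z n).im → L.referenceNorm (f' n - g n) ≤ K / (z n).im * (4 * C + 4 * ε n) := by
    intro n hn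
    have hy1 : 1 ≤ (z n).im := L.one_le_im_of_normThreshold_lt (hz n)
    have hy0 : 0 < (z n).im := hz0 n
    have ht1 : 1 ≤ Real.sqrt (z n).im := by rw [← Real.sqrt_one]; exact Real.sqrt_le_sqrt hy1
    have ht2 : Real.sqrt (z n).im ^ 2 = (z n).im := Real.sq_sqrt hy0.le
    have h1 : L.referenceNorm (g n - f' n) ≤ K / (z n).im * L.referenceNorm (f' n) := by
      have h := hK _ ht1 (f' n)
      rwa [hf'g n, ht2] at h
    have hKy : K / (z n).im ≤ 1 / 2 := by
      rw [div_le_iff₀ hy0]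
      linarith
    -- `|f'|₀ ≤ |g|₀ + |g - f'|₀ ≤ 2C + 2ε + ½|f'|₀`
    have h2 : L.referenceNorm (f' n) ≤ 4 * C + 4 * ε n := by
      have h4 := htri (f' n) (g n)
      rw [hsubrev (f' n) (g n)] at h4
      have h3 : L.referenceNorm (g n - f' n) ≤ 1 / 2 * L.referenceNorm (f' n) :=
        h1.trans (mul_le_mul_of_nonneg_right hKy (L.referenceNorm_nonneg _))
      linarith [hgn n]
    rw [hsubrev (f' n) (g n)]
    exact h1.trans (mul_le_mul_of_nonneg_left h2 (div_nonneg hK0 hy0.le))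
  -- hence `|f' n - w n|₀ ≤ (K / Im (z n)) (4C + 4 ε n) + 2 ε n`
  have hfw_est : ∀ n, 2 * K ≤ (z n).im → L.referenceNorm (f' n - w n) ≤ K / (z n).im * (4 * C + 4 * ε n) + 2 * ε n := by
    intro n hn
    calc L.referenceNorm (f' n - w n) = L.referenceNorm ((f' n - g n) + (g n - w n)) := by rw [sub_add_sub_cancel]
      _ ≤ L.referenceNorm (f' n - g n) + L.referenceNorm (g n - w n) := hadd _ _
      _ ≤ K / (z n).im * (4 * C + 4 * ε n) + 2 * ε n := by rw [hsubrev (g n) (w n)]; linarith [hfg_est n hn, hwg n]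
  -- §3: topology of `(V_ℂ, |·|₀)` and a convergent subsequence of `w`
  letI := P.hodgeNormedAddCommGroup
  letI := P.hodgeInnerProductSpace
  have hnorm : ∀ v : ℂ ⊗[ℚ] V, ‖v‖ = L.referenceNorm v := fun v => rfl
  obtain ⟨a, -, φ, hφ, hlimw⟩ := tendsto_subseq_of_bounded (Metric.isBounded_closedBall (x := (0 : ℂ ⊗[ℚ] V)) (r := 2 * C))
    (x := w) fun n => by rw [Metric.mem_closedBall, dist_zero_right, hnorm]; exact hwn n
  have hdist : Tendsto (fun n => L.referenceNorm (w (φ n) - a)) atTop (𝓝 0) := by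
    have h := tendsto_iff_norm_sub_tendsto_zero.1 hlimw
    exact h
  -- (i) `a ∈ W_k`
  have haW : a ∈ (L.W k).baseChange ℂ :=
    (Submodule.closed_of_finiteDimensional ((L.W k).baseChange ℂ)).mem_of_tendsto hlimw (Eventually.of_forall fun n => hwW (φ n))
  -- (ii) `a` is real
  have hareal : conj a = a := by
    have hle : ∀ n, L.referenceNorm (conj a - a) ≤ 2 * L.referenceNorm (w (φ n) - a) := by
      intro n
      have e : conj a - a = conj (a - w (φ n)) + (w (φ n) - a) := by rw [map_sub, hwr]; abel
      calc L.referenceNorm (conj a - a) = L.referenceNorm (conj (a - w (φ n)) + (w (φ n) - a)) := by rw [e]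
        _ ≤ L.referenceNorm (conj (a - w (φ n))) + L.referenceNorm (w (φ n) - a) := hadd _ _
        _ = 2 * L.referenceNorm (w (φ n) - a) := by rw [hconj, hsubrev a]; ring
    have h0 : L.referenceNorm (conj a - a) ≤ 0 := by
      refine ge_of_tendsto (by simpa using hdist.const_mul 2) (Eventually.of_forall hle)
    exact sub_eq_zero.1 ((L.referenceNorm_eq_zero_iff _).1 (le_antisymm h0 (L.referenceNorm_nonneg _)))
  -- (iii) `a ∈ F̂_♯^p`: `f' (φ n) → a`
  have htφ : Tendsto (fun n => (z (φ n)).im) atTop atTop := hlim.comp hφ.tendsto_atTop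
  have hεφ : Tendsto (fun n => ε (φ n)) atTop (𝓝 0) := hε0.comp hφ.tendsto_atTop
  have hlimf : Tendsto (fun n => f' (φ n)) atTop (𝓝 a) := by
    rw [tendsto_iff_norm_sub_tendsto_zero]
    have hb : Tendsto (fun n => K / (z (φ n)).im * (4 * C + 4 * ε (φ n)) + 2 * ε (φ n) + L.referenceNorm (w (φ n) - a))
        atTop (𝓝 0) := by
      have h1 : Tendsto (fun n => K / (z (φ n)).im) atTop (𝓝 0) := by
        have h := (tendsto_inv_atTop_zero.comp htφ).const_mul K
        rw [mul_zero] at h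
        exact h.congr fun n => by simp [div_eq_mul_inv]
      have h2 : Tendsto (fun n => 4 * C + 4 * ε (φ n)) atTop (𝓝 (4 * C + 4 * 0)) := (hεφ.const_mul 4).const_add (4 * C)
      have h3 : Tendsto (fun n => 2 * ε (φ n)) atTop (𝓝 (2 * 0)) := hεφ.const_mul 2
      have h := ((h1.mul h2).add h3).add hdist
      simpa using h
    refine squeeze_zero' (Eventually.of_forall fun n => norm_nonneg _) ?_ hb
    refine (htφ.eventually (eventually_ge_atTop (2 * K))).mono fun n hn => ?_
    rw [hnorm]
    calc L.referenceNorm (f' (φ n) - a) = L.referenceNorm ((f' (φ n) - w (φ n)) + (w (φ n) - a)) := by rw [sub_add_sub_cancel]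
      _ ≤ L.referenceNorm (f' (φ n) - w (φ n)) + L.referenceNorm (w (φ n) - a) := hadd _ _
      _ ≤ K / (z (φ n)).im * (4 * C + 4 * ε (φ n)) + 2 * ε (φ n) + L.referenceNorm (w (φ n) - a) := by
          linarith [hfw_est (φ n) hn]
  have haF : a ∈ (L.deltaSplit.toLimitMixedHodgeStructure.sharp hs').F p :=
    (Submodule.closed_of_finiteDimensional ((L.deltaSplit.toLimitMixedHodgeStructure.sharp hs').F p)).mem_of_tendsto hlimf
      (Eventually.of_forall fun n => hf'F (φ n))
  -- (iv) `π̂_k a = û`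
  obtain ⟨Cπ, hCπ0, hCπ⟩ := P.exists_hodgeNorm_apply_le (L.deltaSplit.toMixedHodgeStructure.deligneEProj k)
  have haπ : L.deltaSplit.toMixedHodgeStructure.deligneEProj k a = û := by
    have hle : ∀ n, L.referenceNorm (L.deltaSplit.toMixedHodgeStructure.deligneEProj k a - û) ≤ Cπ * L.referenceNorm (w (φ n) - a) := by
      intro n
      have hneg : L.referenceNorm (w (φ n) - a) = L.referenceNorm (a - w (φ n)) := hsubrev _ _
      rw [← hwπ (φ n), ← map_sub, hneg]
      exact hCπ _
    have h0 : L.referenceNorm (L.deltaSplit.toMixedHodgeStructure.deligneEProj k a - û) ≤ 0 := by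
      refine ge_of_tendsto (by simpa using hdist.const_mul Cπ) (Eventually.of_forall hle)
    exact sub_eq_zero.1 ((L.referenceNorm_eq_zero_iff _).1 (le_antisymm h0 (L.referenceNorm_nonneg _)))
  -- (v) Prop. 3.10: `a` is `𝔰𝔩₂`-invariant and of pure weight `k`, hence `a = û`
  obtain ⟨hN, hNp, hH, hI⟩ := L.sl2_invariant_of_conj_eq_of_mem_baseChange_W_of_mem_deltaSplit_sharp_F hpk hareal haW haF
  have haE : L.deltaSplit.toMixedHodgeStructure.deligneEProj k a = a :=
    L.deligneEProj_apply_eq_self_of_mem_baseChange_W_of_mem_sharp_piece haW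
      ((L.deltaSplit.toLimitMixedHodgeStructure.sharp hs').mem_piece_of_conj_eq_of_mem_F hpk hareal haF)
  have hua : û = a := by rw [← haπ, haE]
  rw [hua]
  exact ⟨hN, hNp, hH, hI⟩

/-- **Corollary (the form consumed downstream): `N (π̂_k x_n) = 0`** for every `n` — the constant top class of such a sequence of
approximate Hodge classes is killed by the monodromy logarithm («`u¹` is in the kernel of the morphism (4.6.1)»).
[cite: CattaniDeligneKaplan1995, Prop. 4.7 (p. 503)] -/
theorem N_deligneEProj_eq_zero_of_deligneEProj_eq_const_of_hodgeNorm_sub_le {p : ℤ} (hpk : p + p = k) (x : ℕ → ℂ ⊗[ℚ] V)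
    (z : ℕ → ℂ) (hz : ∀ n, L.normThreshold < (z n).im) (hlim : Tendsto (fun n => (z n).im) atTop atTop) {C : ℝ}
    (hC : ∀ n, (L.nilpotentOrbitPolarization (z n) (L.orbitThreshold_lt_im (hz n))).hodgeNorm (x n) ≤ C)
    (hreal : ∀ n, conj (x n) = x n) (hW : ∀ n, x n ∈ (L.W k).baseChange ℂ) (f : ℕ → ℂ ⊗[ℚ] V)
    (hf : ∀ n, f n ∈ (L.nilpotentOrbit (z n) (L.orbitThreshold_lt_im (hz n))).F p) (ε : ℕ → ℝ)
    (hε : ∀ n, (L.nilpotentOrbitPolarization (z n) (L.orbitThreshold_lt_im (hz n))).hodgeNorm (x n - f n) ≤ ε n)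
    (hε0 : Tendsto ε atTop (𝓝 0)) {û : ℂ ⊗[ℚ] V} (hû : ∀ n, L.deltaSplit.toMixedHodgeStructure.deligneEProj k (x n) = û) (n : ℕ) :
    L.N.baseChange ℂ (L.deltaSplit.toMixedHodgeStructure.deligneEProj k (x n)) = 0 := by
  rw [hû n]
  exact (L.sl2_invariant_of_deligneEProj_eq_const_of_hodgeNorm_sub_le hpk x z hz hlim hC hreal hW f hf ε hε hε0 hû).1

/-! ## §3 Variants: the truncation form, the relative (2.15) form, and the exact case recovered -/

/-- **Truncation form**: with the canonical witness `f_n = π_{≥p} x_n` of `F^pθ(z_n)`, the hypothesis reads `‖π_{<p} x_n‖_{θ(z_n)} ≤ ε_n → 0`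
(`Motives/HodgeStructureApproximateHodgeClasses`: `‖x − π_{≥p} x‖ = ‖π_{<p} x‖`). [cite: CattaniDeligneKaplan1995, Prop. 4.7 (p. 503) and 2.15 (p. 491)] -/
theorem sl2_invariant_of_deligneEProj_eq_const_of_hodgeNorm_truncLT_le {p : ℤ} (hpk : p + p = k) (x : ℕ → ℂ ⊗[ℚ] V) (z : ℕ → ℂ)
    (hz : ∀ n, L.normThreshold < (z n).im) (hlim : Tendsto (fun n => (z n).im) atTop atTop) {C : ℝ}
    (hC : ∀ n, (L.nilpotentOrbitPolarization (z n) (L.orbitThreshold_lt_im (hz n))).hodgeNorm (x n) ≤ C)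
    (hreal : ∀ n, conj (x n) = x n) (hW : ∀ n, x n ∈ (L.W k).baseChange ℂ) (ε : ℕ → ℝ)
    (hε : ∀ n, (L.nilpotentOrbitPolarization (z n) (L.orbitThreshold_lt_im (hz n))).hodgeNorm
      ((L.nilpotentOrbit (z n) (L.orbitThreshold_lt_im (hz n))).truncLT p (x n)) ≤ ε n)
    (hε0 : Tendsto ε atTop (𝓝 0)) {û : ℂ ⊗[ℚ] V} (hû : ∀ n, L.deltaSplit.toMixedHodgeStructure.deligneEProj k (x n) = û) :
    L.N.baseChange ℂ û = 0 ∧ L.deltaSplit.toLimitMixedHodgeStructure.nPlus û = 0 ∧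
      L.deltaSplit.toLimitMixedHodgeStructure.deligneH û = 0 ∧ û ∈ L.deltaSplit.toMixedHodgeStructure.deligneI p p := by
  refine L.sl2_invariant_of_deligneEProj_eq_const_of_hodgeNorm_sub_le hpk x z hz hlim hC hreal hW
    (fun n => (L.nilpotentOrbit (z n) (L.orbitThreshold_lt_im (hz n))).truncGE p (x n))
    (fun n => HodgeStructure.truncGE_mem_F _ p (x n)) ε (fun n => ?_) hε0 hû
  have e : x n - (L.nilpotentOrbit (z n) (L.orbitThreshold_lt_im (hz n))).truncGE p (x n) =
      (L.nilpotentOrbit (z n) (L.orbitThreshold_lt_im (hz n))).truncLT p (x n) := by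
    rw [sub_eq_iff_eq_add, add_comm, HodgeStructure.truncGE_apply_add_truncLT_apply]
  rw [e]
  exact hε n

/-- **Relative form (CDK 2.15): `‖x_n − f_n‖_{θ(z_n)} ≤ δ_n ‖x_n‖_{θ(z_n)}` with `δ_n → 0`** (e.g. `δ_n = exp(−α Im z_n)`, the printed
`u(n) ∼_{z(n)} Φ⁰(z(n))`) and `‖x_n‖_{θ(z_n)} ≤ C`: the same conclusion. [cite: CattaniDeligneKaplan1995, Prop. 4.7 (p. 503), 4.1 (p. 499) and 2.15 (p. 491)] -/
theorem sl2_invariant_of_deligneEProj_eq_const_of_hodgeNorm_sub_le_mul {p : ℤ} (hpk : p + p = k) (x : ℕ → ℂ ⊗[ℚ] V) (z : ℕ → ℂ)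
    (hz : ∀ n, L.normThreshold < (z n).im) (hlim : Tendsto (fun n => (z n).im) atTop atTop) {C : ℝ}
    (hC : ∀ n, (L.nilpotentOrbitPolarization (z n) (L.orbitThreshold_lt_im (hz n))).hodgeNorm (x n) ≤ C)
    (hreal : ∀ n, conj (x n) = x n) (hW : ∀ n, x n ∈ (L.W k).baseChange ℂ) (f : ℕ → ℂ ⊗[ℚ] V)
    (hf : ∀ n, f n ∈ (L.nilpotentOrbit (z n) (L.orbitThreshold_lt_im (hz n))).F p) (δ : ℕ → ℝ) (hδ_nonneg : ∀ n, 0 ≤ δ n)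
    (hδ : ∀ n, (L.nilpotentOrbitPolarization (z n) (L.orbitThreshold_lt_im (hz n))).hodgeNorm (x n - f n) ≤
      δ n * (L.nilpotentOrbitPolarization (z n) (L.orbitThreshold_lt_im (hz n))).hodgeNorm (x n))
    (hδ0 : Tendsto δ atTop (𝓝 0)) {û : ℂ ⊗[ℚ] V} (hû : ∀ n, L.deltaSplit.toMixedHodgeStructure.deligneEProj k (x n) = û) :
    L.N.baseChange ℂ û = 0 ∧ L.deltaSplit.toLimitMixedHodgeStructure.nPlus û = 0 ∧
      L.deltaSplit.toLimitMixedHodgeStructure.deligneH û = 0 ∧ û ∈ L.deltaSplit.toMixedHodgeStructure.deligneI p p := by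
  have hC0 : 0 ≤ C := (HodgeStructure.Polarization.hodgeNorm_nonneg _ _).trans (hC 0)
  refine L.sl2_invariant_of_deligneEProj_eq_const_of_hodgeNorm_sub_le hpk x z hz hlim hC hreal hW f hf (fun n => δ n * C)
    (fun n => (hδ n).trans (mul_le_mul_of_nonneg_left (hC n) (hδ_nonneg n))) ?_ hû
  have h := hδ0.mul_const C
  rwa [zero_mul] at h

/-- **The exponential form of 2.15 / 4.1: `‖x_n − f_n‖_{θ(z_n)} ≤ exp(−α Im z_n) ‖x_n‖_{θ(z_n)}`, `α > 0`** — the printed hypothesis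
«for some fixed `α > 0`, `u(n) ∼_{z(n)} Φ⁰(z(n))`». [cite: CattaniDeligneKaplan1995, 4.1 (p. 499), 2.15 (p. 491), Prop. 4.7 (p. 503)] -/
theorem sl2_invariant_of_deligneEProj_eq_const_of_hodgeNorm_sub_le_exp {p : ℤ} (hpk : p + p = k) (x : ℕ → ℂ ⊗[ℚ] V) (z : ℕ → ℂ)
    (hz : ∀ n, L.normThreshold < (z n).im) (hlim : Tendsto (fun n => (z n).im) atTop atTop) {C : ℝ}
    (hC : ∀ n, (L.nilpotentOrbitPolarization (z n) (L.orbitThreshold_lt_im (hz n))).hodgeNorm (x n) ≤ C)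
    (hreal : ∀ n, conj (x n) = x n) (hW : ∀ n, x n ∈ (L.W k).baseChange ℂ) (f : ℕ → ℂ ⊗[ℚ] V)
    (hf : ∀ n, f n ∈ (L.nilpotentOrbit (z n) (L.orbitThreshold_lt_im (hz n))).F p) {α : ℝ} (hα : 0 < α)
    (hδ : ∀ n, (L.nilpotentOrbitPolarization (z n) (L.orbitThreshold_lt_im (hz n))).hodgeNorm (x n - f n) ≤
      Real.exp (-α * (z n).im) * (L.nilpotentOrbitPolarization (z n) (L.orbitThreshold_lt_im (hz n))).hodgeNorm (x n))
    {û : ℂ ⊗[ℚ] V} (hû : ∀ n, L.deltaSplit.toMixedHodgeStructure.deligneEProj k (x n) = û) :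
    L.N.baseChange ℂ û = 0 ∧ L.deltaSplit.toLimitMixedHodgeStructure.nPlus û = 0 ∧
      L.deltaSplit.toLimitMixedHodgeStructure.deligneH û = 0 ∧ û ∈ L.deltaSplit.toMixedHodgeStructure.deligneI p p := by
  refine L.sl2_invariant_of_deligneEProj_eq_const_of_hodgeNorm_sub_le_mul hpk x z hz hlim hC hreal hW f hf
    (fun n => Real.exp (-α * (z n).im)) (fun n => (Real.exp_pos _).le) hδ ?_ hû
  have h1 : Tendsto (fun n => -α * (z n).im) atTop atBot := by
    have h := hlim.const_mul_atTop_of_neg (neg_lt_zero.2 hα)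
    exact h
  exact Real.tendsto_exp_atBot.comp h1

/-- **The exact case recovered** (`ε_n = 0`, `f_n = x_n ∈ F^pθ(z_n)`): the hypothesis of `…RescaledLimit`'s theorem in the middle
weight `k = p + p`, through the approximate theorem. [cite: CattaniDeligneKaplan1995, Prop. 4.7 (p. 503)] -/
theorem sl2_invariant_of_deligneEProj_eq_const_of_mem_F {p : ℤ} (hpk : p + p = k) (x : ℕ → ℂ ⊗[ℚ] V) (z : ℕ → ℂ)
    (hz : ∀ n, L.normThreshold < (z n).im) (hlim : Tendsto (fun n => (z n).im) atTop atTop) {C : ℝ}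
    (hC : ∀ n, (L.nilpotentOrbitPolarization (z n) (L.orbitThreshold_lt_im (hz n))).hodgeNorm (x n) ≤ C)
    (hreal : ∀ n, conj (x n) = x n) (hW : ∀ n, x n ∈ (L.W k).baseChange ℂ)
    (hx : ∀ n, x n ∈ (L.nilpotentOrbit (z n) (L.orbitThreshold_lt_im (hz n))).F p) {û : ℂ ⊗[ℚ] V}
    (hû : ∀ n, L.deltaSplit.toMixedHodgeStructure.deligneEProj k (x n) = û) :
    L.N.baseChange ℂ û = 0 ∧ L.deltaSplit.toLimitMixedHodgeStructure.nPlus û = 0 ∧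
      L.deltaSplit.toLimitMixedHodgeStructure.deligneH û = 0 ∧ û ∈ L.deltaSplit.toMixedHodgeStructure.deligneI p p :=
  L.sl2_invariant_of_deligneEProj_eq_const_of_hodgeNorm_sub_le hpk x z hz hlim hC hreal hW x hx (fun _ => 0)
    (fun n => by rw [sub_self, HodgeStructure.Polarization.hodgeNorm_zero]) tendsto_const_nhds hû

end PolarizedLimitMixedHodgeStructure

end HodgeTheory

end Literature.AlgebraicGeometry

end
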